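import Summits.ResolutionOfSingularities.ResolutionOfSingularities.Theorems.FrobeniusLadderFRationalResolutionIsolatedFixedChartResolution
import Summits.ResolutionOfSingularities.ResolutionOfSingularities.Theorems.FrobeniusLadderFRationalResolutionFixedPointResolvableNhd
import Summits.ResolutionOfSingularities.ResolutionOfSingularities.Theorems.FrobeniusLadderFRationalResolutionRegularConeRegularPoint
import Summits.ResolutionOfSingularities.ResolutionOfSingularities.Theorems.FrobeniusLadderFRationalResolutionIsolatedClosed
import Summits.ResolutionOfSingularities.ResolutionOfSingularities.Theorems.FrobeniusLadderFRationalResolutionRegularPointRegularCone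
import Literature.AlgebraicGeometry.Resolution.RegularLocusOpen
import Literature.AlgebraicGeometry.Resolution.MarkedIdealsEtale
import Mathlib.AlgebraicGeometry.Morphisms.QuasiFinite
import Mathlib.RingTheory.Unramified.LocalStructure
import HarnessLib

/-!
# Crux `FrobeniusLadder.FRationalResolution` (stmt-ResolutionOfSingularities-15317), line `redirect`,
# stub `stub_diagonalizableQuotientResolution` — ASSEMBLY (ε₂″, chart side): ISOLATED singularities over an
# algebraically closed field which are étale-locally points of AFFINE log regular charts with unit face `0` and
# simplicial fan ARE RESOLVABLE

The assembly (ε₂′) `…IsolatedFixedChartResolution.hasResolution_of_isolated_logRegular_fixed_charts_of_isAlgClosed`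
asks, at the chart point `y` over each singular `x`, for SCHEME-side data: `y` closed, an affine open `V ∋ y` whose
coordinate ring carries an fs spanning chart log regular at EVERY prime, `ψ(P ∖ 0) ⊆ 𝔮_y`, `dim = n`, every OTHER
prime of `Γ(Y, V)` regular, face fan of `P^∨` primitively simplicial and NOT regular. This file discharges the
plumbing from honest RING data on an affine étale chart `φ : Spec R → X`, `φ y = x`: a chart `ψ : P → R` log regular
on a basic open `D(g) ∋ y`, `ψ(P ∖ 0) ⊆ 𝔮_y`, `dim R_{𝔮_y} = n` and a primitively simplicial face fan. What is derived
here: (1) `y` is CLOSED (primes of an unramified algebra over the maximal ideal of the closed point `x` are maximal;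
Jacobson); (2) the punctured neighbourhood is REGULAR — `φ` is locally quasi-finite (Mathlib: unramified essentially
finite type ⇒ quasi-finite), so `y` is isolated in its fibre, the other singular points of `X` are finitely many
closed points, and regularity ascends along the étale `φ` (`isRegularLocalRing_stalk_iff_of_etale`); (3) the face fan
is NOT regular, since a regular fan at a point with unit face `0` forces a regular local ring
(`LogChart.isRegularLocalRing_of_isRegular_ofCone`) while `x` is singular; (4) the chart passes to the coordinate ring
`Γ(Spec R, D(h))` of a small basic open (`isLogRegularAt_of_isLocalization`, Mathlib's `IsLocalization.Away h
Γ(Spec R, D(h))`), with `𝔮_y`, the dimension and the stalks read through `IsAffineOpen.primeIdealOf` /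
`IsAffineOpen.fromSpec`.

* `locallyQuasiFinite_of_etale` — an étale morphism is locally quasi-finite;
* `algebraMap_mem_primeIdealOf_iff` — for `V ⊆ Spec R` affine and `y ∈ V`: `r ↦ Γ(Spec R, V)` lands in `𝔮_y` iff `r ∈ y`;
* `ringKrullDim_atPrime_primeIdealOf` — `dim Γ(Spec R, V)_{𝔮_y} = dim R_y`;
* **`hasResolution_of_isolated_affine_logRegular_charts_of_isAlgClosed`** — THE THEOREM of this file.

Honest label: assembly/plumbing toward the ISOLATED case of the stub over `K = K̄` (no stub closed by name); the
remaining input at a `D(A)`-fixed point of a quotient chart is the simpliciality of the normalised fixed-point chart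
monoid (`…FixedPointLogRegularNhd`, `…ChartNormalization`, `…FixedPointDimension` give the rest). No definitions, no
named facts, no sorry. [cite: Kato1994, Def. (2.1), (10.4)] [cite: Kollar2007, §2.2] [cite: StacksProject, Tag 02G7; Tag 01TB]
-/

noncomputable section

-- single-problem summit: the doubled namespace component is forced
set_option linter.dupNamespace false

open CategoryTheory AlgebraicGeometry TopologicalSpace
open Literature.AlgebraicGeometry.Resolution Literature.Geometry.PolyhedralFans
open Literature.AlgebraicGeometry.Resolution.LogBlowup Literature.AlgebraicGeometry.Resolution.LogChart
open Summit.ResolutionOfSingularities.ResolutionOfSingularities.Theorems.FRationalResolution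

namespace Summit.ResolutionOfSingularities.ResolutionOfSingularities.Theorems.FRationalResolution.IsolatedAffineLogRegularChartResolution

/-! ## Small inputs -/

/-- **An étale morphism is locally quasi-finite** (on affine pieces it is an étale, hence unramified finite-type,
ring map; Mathlib: unramified + essentially of finite type ⇒ quasi-finite). [cite: StacksProject, Tag 02G7] -/
theorem locallyQuasiFinite_of_etale {Y X : Scheme.{0}} (φ : Y ⟶ X) [Etale φ] : LocallyQuasiFinite φ := by
  refine ⟨fun {U} hU {V} hV e => ?_⟩
  have h : (φ.appLE U V e).hom.Etale := φ.etale_appLE hU hV e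
  letI : Algebra Γ(X, U) Γ(Y, V) := (φ.appLE U V e).hom.toAlgebra
  haveI : Algebra.Etale Γ(X, U) Γ(Y, V) := h
  show Algebra.QuasiFinite Γ(X, U) Γ(Y, V)
  infer_instance

/-- **Membership in `𝔮_y ⊆ Γ(Spec R, V)` is read in `R`**: for an affine open `V ∋ y` of `Spec R` and `r ∈ R`, the
image of `r` in `Γ(Spec R, V)` lies in the prime of `y` iff `r ∈ y` (both say that the germ of `r` at `y` is not a
unit). [folklore; cite: StacksProject, Tag 01HR] -/
theorem algebraMap_mem_primeIdealOf_iff {R : CommRingCat.{0}} {V : (Spec R).Opens} (hV : IsAffineOpen V)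
    {y : Spec R} (hyV : y ∈ V) (r : R) :
    algebraMap R Γ(Spec R, V) r ∈ (hV.primeIdealOf ⟨y, hyV⟩).asIdeal ↔ r ∈ y.asIdeal := by
  letI := (Spec R).presheaf.algebra_section_stalk ⟨y, hyV⟩
  haveI := hV.isLocalization_stalk ⟨y, hyV⟩
  rw [← IsLocalization.AtPrime.to_map_mem_maximal_iff ((Spec R).presheaf.stalk y)
    (hV.primeIdealOf ⟨y, hyV⟩).asIdeal, IsLocalRing.mem_maximalIdeal, mem_nonunits_iff,
    IsAffineOpen.algebraMap_Spec_obj]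
  change ¬ IsUnit (((Spec R).presheaf.germ V y hyV)
      (((Spec R).presheaf.map (homOfLE le_top).op) ((Scheme.ΓSpecIso R).inv r))) ↔ _
  rw [TopCat.Presheaf.germ_res_apply' _ _ _ hyV, ← Scheme.mem_basicOpen_top, basicOpen_eq_of_affine]
  exact (not_congr (PrimeSpectrum.mem_basicOpen r y)).trans not_not

/-- **`dim Γ(Spec R, V)_{𝔮_y} = dim R_y`**: both local rings are the stalk of `Spec R` at `y`.
[folklore; cite: StacksProject, Tag 01HR] -/
theorem ringKrullDim_atPrime_primeIdealOf {R : CommRingCat.{0}} {V : (Spec R).Opens} (hV : IsAffineOpen V)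
    {y : Spec R} (hyV : y ∈ V) :
    ringKrullDim (Localization.AtPrime (hV.primeIdealOf ⟨y, hyV⟩).asIdeal) =
      ringKrullDim (Localization.AtPrime y.asIdeal) := by
  letI := (Spec R).presheaf.algebra_section_stalk ⟨y, hyV⟩
  haveI := hV.isLocalization_stalk ⟨y, hyV⟩
  let e₁ : Localization.AtPrime (hV.primeIdealOf ⟨y, hyV⟩).asIdeal ≃ₐ[Γ(Spec R, V)]
      (Spec R).presheaf.stalk y :=
    IsLocalization.algEquiv (hV.primeIdealOf ⟨y, hyV⟩).asIdeal.primeCompl _ _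
  let e₂ : (Spec.structureSheaf R).presheaf.stalk y ≃ₐ[R] Localization.AtPrime y.asIdeal :=
    IsLocalization.algEquiv y.asIdeal.primeCompl _ _
  rw [ringKrullDim_eq_of_ringEquiv e₁.toRingEquiv]
  change ringKrullDim ((Spec.structureSheaf R).presheaf.stalk y) = _
  exact ringKrullDim_eq_of_ringEquiv e₂.toRingEquiv

/-! ## The theorem -/

/-- **(ε₂″) Isolated singularities over `K = K̄` that are étale-locally points of affine log regular charts with unit
face `0` and simplicial fan are resolvable.** Let `X` be integral, locally of finite type over an algebraically closed
field `K`, with finitely many singular points. Suppose every singular `x` is `φ y` for an étale `φ : Spec R → X` and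
a point `y`, where `R` carries a chart `ψ : P → R` (`P ⊆ ℤⁿ` finitely generated, saturated, spanning) which is Kato
log regular at every prime of a basic open `D(g) ∋ y`, with `ψ(P ∖ 0) ⊆ 𝔮_y`, `dim R_{𝔮_y} = n`, and the face fan of
`P^∨` primitively simplicial. Then `X` has a resolution of singularities. (Derived inside: `y` closed, the punctured
chart neighbourhood regular, the fan not regular; then (ε₂′).) [cite: Kato1994, (10.4)] [cite: Kollar2007, §2.2] -/
theorem hasResolution_of_isolated_affine_logRegular_charts_of_isAlgClosed (K : Type) [Field K] [IsAlgClosed K]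
    (X : Scheme.{0}) [IsIntegral X] (f : X ⟶ Spec (.of K)) [LocallyOfFiniteType f]
    (hfin : (Scheme.regularLocus X)ᶜ.Finite)
    (hchart : ∀ x : X, x ∉ Scheme.regularLocus X →
      ∃ (R : CommRingCat.{0}) (φ : Spec R ⟶ X) (_ : Etale φ) (y : Spec R) (_ : φ y = x)
        (n : ℕ) (P : AddSubmonoid (Fin n → ℤ)) (hP : P.FG)
        (_ : ∀ (v : Fin n → ℤ) (k : ℕ), 0 < k → k • v ∈ P → v ∈ P)
        (hspan : Submodule.span ℤ (P : Set (Fin n → ℤ)) = ⊤)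
        (ψ : Multiplicative P →* R) (g : R),
        g ∉ y.asIdeal ∧
        (∀ (𝔭 : Ideal R) [𝔭.IsPrime], g ∉ 𝔭 → IsLogRegularAt P ψ 𝔭) ∧
        (∀ p : P, (p : Fin n → ℤ) ≠ 0 → ψ (Multiplicative.ofAdd p) ∈ y.asIdeal) ∧
        ringKrullDim (Localization.AtPrime y.asIdeal) = n ∧
        (Fan.ofCone (dualCone P) (dualCone_fg P hP) (isSalient_dualCone P hspan)).IsPrimSimplicial) :
    Scheme.HasResolution X := by
  classical
  haveI : IsLocallyNoetherian X := LocallyOfFiniteType.isLocallyNoetherian f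
  refine IsolatedFixedChartResolution.hasResolution_of_isolated_logRegular_fixed_charts_of_isAlgClosed K X f hfin
    fun x hx => ?_
  obtain ⟨R, φ, _, y, hyx, n, P, hP, hsat, hspan, ψ, g, hgy, hreg, hfix, hdim, hps⟩ := hchart x hx
  subst hyx
  -- the chart scheme `Y = Spec R`
  haveI : IsLocallyNoetherian (Spec R) := LocallyOfFiniteType.isLocallyNoetherian φ
  haveI : JacobsonSpace (Spec R) := LocallyOfFiniteType.jacobsonSpace (φ ≫ f)
  haveI : LocallyQuasiFinite φ := locallyQuasiFinite_of_etale φ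
  -- (a) `φ y` is closed; an affine open `U ∋ φ y`
  have hxcl : IsClosed ({φ y} : Set X) := IsolatedClosed.isClosed_singleton_of_finite_singularLocus K X f hfin hx
  obtain ⟨U, hU, hxU, -⟩ := exists_isAffineOpen_mem_and_subset (X := X) (x := φ y) (U := ⊤) trivial
  -- (b) the other singular points form a finite closed set
  set T : Set X := (Scheme.regularLocus X)ᶜ \ {φ y} with hT
  have hTclosed : IsClosed T := by
    rw [← Set.biUnion_of_singleton T]
    exact (hfin.subset fun z hz => hz.1).isClosed_biUnion fun z hz =>
      IsolatedClosed.isClosed_singleton_of_finite_singularLocus K X f hfin hz.1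
  -- (c) `y` is isolated in its fibre
  obtain ⟨u, huopen, hu⟩ := (isDiscrete_iff_forall_mem_exists_isOpen.mp (φ.isDiscrete_preimage_singleton (φ y)))
    y rfl
  -- (d) the open neighbourhood `W` of `y` and a basic open `D(h) ∋ y` inside it
  set W : (Spec R).Opens :=
    ⟨u, huopen⟩ ⊓ φ ⁻¹ᵁ ⟨Tᶜ, hTclosed.isOpen_compl⟩ ⊓ φ ⁻¹ᵁ U ⊓ PrimeSpectrum.basicOpen g with hWdef
  have hyW : y ∈ W := by
    refine ⟨⟨⟨?_, ?_⟩, hxU⟩, (PrimeSpectrum.mem_basicOpen _ _).mpr hgy⟩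
    · simpa [Set.mem_singleton_iff] using (show y ∈ u ∩ φ ⁻¹' {φ y} by rw [hu]; rfl)
    · show φ y ∈ Tᶜ
      exact fun h => h.2 rfl
  obtain ⟨_, ⟨h, rfl⟩, hyh, hhW⟩ := (Opens.isBasis_iff_nbhd.mp PrimeSpectrum.isBasis_basic_opens) hyW
  -- (e) the affine open `V = D(h)` and its coordinate ring
  set V : (Spec R).Opens := PrimeSpectrum.basicOpen h with hVdef
  have hV : IsAffineOpen V := by
    rw [hVdef, ← basicOpen_eq_of_affine]
    exact (isAffineOpen_top (Spec R)).basicOpen _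
  have hyV : y ∈ V := hyh
  have hVW : V ≤ W := hhW
  haveI : IsNoetherianRing Γ(Spec R, V) := IsLocallyNoetherian.component_noetherian ⟨V, hV⟩
  set 𝔮 := hV.primeIdealOf ⟨y, hyV⟩ with h𝔮def
  -- the chart on `Γ(Spec R, D(h))`
  let ψV : Multiplicative P →* Γ(Spec R, V) := (algebraMap R Γ(Spec R, V)).toMonoidHom.comp ψ
  have hregV : ∀ (𝔓 : Ideal Γ(Spec R, V)) [𝔓.IsPrime], IsLogRegularAt P ψV 𝔓 := by
    intro 𝔓 _
    refine FixedPointResolvableNhd.isLogRegularAt_of_isLocalization (Submonoid.powers h) P ψ 𝔓 (hreg _ ?_)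
    -- `g ∉ 𝔓 ∩ R` since `D(h) ⊆ D(g)`
    have hh𝔓 : h ∉ 𝔓.comap (algebraMap R Γ(Spec R, V)) := fun hh =>
      ‹𝔓.IsPrime›.ne_top (Ideal.eq_top_of_isUnit_mem _ (Ideal.mem_comap.mp hh)
        (IsLocalization.Away.algebraMap_isUnit h))
    have hmem : (⟨𝔓.comap (algebraMap R Γ(Spec R, V)), inferInstance⟩ : PrimeSpectrum R) ∈ V :=
      (PrimeSpectrum.mem_basicOpen _ _).mpr hh𝔓
    exact (PrimeSpectrum.mem_basicOpen _ _).mp (hVW hmem).2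
  have hfixV : ∀ p : P, (p : Fin n → ℤ) ≠ 0 → ψV (Multiplicative.ofAdd p) ∈ 𝔮.asIdeal := fun p hp =>
    (algebraMap_mem_primeIdealOf_iff hV hyV _).mpr (hfix p hp)
  have hdimV : ringKrullDim (Localization.AtPrime 𝔮.asIdeal) = n := by
    rw [h𝔮def, ringKrullDim_atPrime_primeIdealOf hV hyV, hdim]
  -- (f) every other point of `V` is a regular point
  have hV_W : ∀ {z : Spec R}, z ∈ V → z ≠ y → z ∈ Scheme.regularLocus (Spec R) := by
    intro z hzV hzy
    have hzW : z ∈ W := hVW hzV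
    have hφz : φ z ≠ φ y := fun hzz => hzy (by
      have : z ∈ u ∩ φ ⁻¹' {φ y} := ⟨hzW.1.1.1, hzz⟩
      rw [hu] at this
      exact this)
    have hφreg : φ z ∈ Scheme.regularLocus X := by
      by_contra hc
      exact (show φ z ∈ Tᶜ from hzW.1.1.2) ⟨hc, hφz⟩
    rw [Scheme.mem_regularLocus] at hφreg ⊢
    exact (isRegularLocalRing_stalk_iff_of_etale φ z).mpr hφreg
  have hisolV : ∀ (𝔓 : Ideal Γ(Spec R, V)) [𝔓.IsPrime], 𝔓 ≠ 𝔮.asIdeal →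
      IsRegularLocalRing (Localization.AtPrime 𝔓) := by
    intro 𝔓 _ hne
    set z : PrimeSpectrum Γ(Spec R, V) := ⟨𝔓, inferInstance⟩ with hzdef
    have hzV : hV.fromSpec z ∈ V := hV.range_fromSpec.le ⟨z, rfl⟩
    have hzy : hV.fromSpec z ≠ y := fun hzy => hne (by
      have h2 : hV.fromSpec z = hV.fromSpec 𝔮 := by rw [hzy, h𝔮def, hV.fromSpec_primeIdealOf ⟨y, hyV⟩]
      exact congrArg PrimeSpectrum.asIdeal (hV.fromSpec.isOpenEmbedding.injective h2))
    have hz := hV_W hzV hzy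
    rw [mem_regularLocus_fromSpec_iff hV, mem_regularLocus] at hz
    exact hz
  -- (g) the face fan is not regular: else `y`, hence `φ y`, would be a regular point
  have hnregV : ¬ (Fan.ofCone (dualCone P) (dualCone_fg P hP) (isSalient_dualCone P hspan)).IsRegular := by
    intro hΔ
    have hregq : IsRegularLocalRing (Localization.AtPrime 𝔮.asIdeal) :=
      isRegularLocalRing_of_isRegular_ofCone hP hsat hspan (hregV 𝔮.asIdeal) hfixV hΔ
    have hyreg : y ∈ Scheme.regularLocus (Spec R) := by
      have h1 := (mem_regularLocus_fromSpec_iff hV 𝔮).mpr ((mem_regularLocus 𝔮).mpr hregq)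
      rwa [h𝔮def, hV.fromSpec_primeIdealOf ⟨y, hyV⟩] at h1
    rw [Scheme.mem_regularLocus] at hyreg
    exact hx ((Scheme.mem_regularLocus _).mpr ((isRegularLocalRing_stalk_iff_of_etale φ y).mp hyreg))
  -- (h) `y` is a closed point: `𝔮` is maximal (unramified over the maximal ideal of `φ y`), and `Spec R` is Jacobson
  have h𝔮max : 𝔮.asIdeal.IsMaximal := by
    set 𝔭 := hU.primeIdealOf ⟨φ y, hxU⟩ with h𝔭def
    haveI h𝔭max : 𝔭.asIdeal.IsMaximal := hU.primeIdealOf_isMaximal_of_isClosed ⟨φ y, hxU⟩ hxcl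
    have eVU : V ≤ φ ⁻¹ᵁ U := fun z hz => (hVW hz).1.2
    have hψ' : (φ.appLE U V eVU).hom.Etale := φ.etale_appLE hU hV eVU
    letI : Algebra Γ(X, U) Γ(Spec R, V) := (φ.appLE U V eVU).hom.toAlgebra
    haveI : Algebra.Etale Γ(X, U) Γ(Spec R, V) := hψ'
    have hcomap : 𝔮.asIdeal.comap (algebraMap Γ(X, U) Γ(Spec R, V)) = 𝔭.asIdeal :=
      congrArg PrimeSpectrum.asIdeal (hU.comap_primeIdealOf_appLE (f := φ) U V hV eVU hyV)
    exact EtaleChartPrimaryCentreAlgClosed.isMaximal_of_isMaximal_comap_of_formallyUnramified 𝔮.asIdeal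
      (hcomap ▸ h𝔭max)
  have hycl : IsClosed ({y} : Set (Spec R)) := by
    have h1 : IsClosed ({𝔮} : Set (PrimeSpectrum Γ(Spec R, V))) :=
      (PrimeSpectrum.isClosed_singleton_iff_isMaximal 𝔮).mpr h𝔮max
    have h2 : 𝔮 ∈ hV.fromSpec ⁻¹' closedPoints (Spec R) := by
      rw [hV.fromSpec.isOpenEmbedding.preimage_closedPoints]
      exact h1
    have h3 : hV.fromSpec 𝔮 ∈ closedPoints (Spec R) := h2
    rw [h𝔮def, hV.fromSpec_primeIdealOf ⟨y, hyV⟩] at h3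
    exact h3
  -- (i) assemble (ε₂′)'s chart data
  exact ⟨Spec R, φ, inferInstance, y, rfl, hycl, V, hV, hyV, inferInstance, n, P, hP, hsat, hspan, ψV,
    hregV, hfixV, hdimV, hisolV, hps, hnregV⟩

end Summit.ResolutionOfSingularities.ResolutionOfSingularities.Theorems.FRationalResolution.IsolatedAffineLogRegularChartResolution

end

/-! ## Appendix (same generation): the dimension hypothesis removed

With `…RegularPointRegularCone` (κ″: at a unit-face-`0` point, regular local ring ⇒ regular fan; hence at an isolated singular
fixed point the Kato ideal is `𝔮`-primary and `dim = n`) the hypothesis `ringKrullDim R_{𝔮_y} = n` of the theorem above is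
derived inside. -/

noncomputable section

-- single-problem summit: the doubled namespace component is forced
set_option linter.dupNamespace false

open CategoryTheory AlgebraicGeometry TopologicalSpace
open Literature.AlgebraicGeometry.Resolution Literature.Geometry.PolyhedralFans
open Literature.AlgebraicGeometry.Resolution.LogBlowup Literature.AlgebraicGeometry.Resolution.LogChart
open Summit.ResolutionOfSingularities.ResolutionOfSingularities.Theorems.FRationalResolution

namespace Summit.ResolutionOfSingularities.ResolutionOfSingularities.Theorems.FRationalResolution.IsolatedAffineLogRegularChartResolution

/-- **(ε₂″, sharpened) Same as `hasResolution_of_isolated_affine_logRegular_charts_of_isAlgClosed` WITHOUT the dimension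
hypothesis `dim R_{𝔮_y} = n`**: at an isolated singular point with unit face `0` the Kato ideal is `𝔮`-primary, so Kato's
(2.1)(ii) forces `dim = n` (`…RegularPointRegularCone.ringKrullDim_eq_of_isolated`, applied on the punctured-regular affine
neighbourhood `V`). [cite: Kato1994, Def. (2.1), (6.1), (10.4)] [cite: Kollar2007, §2.2] -/
theorem hasResolution_of_isolated_affine_logRegular_charts_of_isAlgClosed' (K : Type) [Field K] [IsAlgClosed K]
    (X : Scheme.{0}) [IsIntegral X] (f : X ⟶ Spec (.of K)) [LocallyOfFiniteType f]
    (hfin : (Scheme.regularLocus X)ᶜ.Finite)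
    (hchart : ∀ x : X, x ∉ Scheme.regularLocus X →
      ∃ (R : CommRingCat.{0}) (φ : Spec R ⟶ X) (_ : Etale φ) (y : Spec R) (_ : φ y = x)
        (n : ℕ) (P : AddSubmonoid (Fin n → ℤ)) (hP : P.FG)
        (_ : ∀ (v : Fin n → ℤ) (k : ℕ), 0 < k → k • v ∈ P → v ∈ P)
        (hspan : Submodule.span ℤ (P : Set (Fin n → ℤ)) = ⊤)
        (ψ : Multiplicative P →* R) (g : R),
        g ∉ y.asIdeal ∧
        (∀ (𝔭 : Ideal R) [𝔭.IsPrime], g ∉ 𝔭 → IsLogRegularAt P ψ 𝔭) ∧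
        (∀ p : P, (p : Fin n → ℤ) ≠ 0 → ψ (Multiplicative.ofAdd p) ∈ y.asIdeal) ∧
        (Fan.ofCone (dualCone P) (dualCone_fg P hP) (isSalient_dualCone P hspan)).IsPrimSimplicial) :
    Scheme.HasResolution X := by
  classical
  haveI : IsLocallyNoetherian X := LocallyOfFiniteType.isLocallyNoetherian f
  refine IsolatedFixedChartResolution.hasResolution_of_isolated_logRegular_fixed_charts_of_isAlgClosed K X f hfin
    fun x hx => ?_
  obtain ⟨R, φ, _, y, hyx, n, P, hP, hsat, hspan, ψ, g, hgy, hreg, hfix, hps⟩ := hchart x hx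
  subst hyx
  -- the chart scheme `Y = Spec R`
  haveI : IsLocallyNoetherian (Spec R) := LocallyOfFiniteType.isLocallyNoetherian φ
  haveI : JacobsonSpace (Spec R) := LocallyOfFiniteType.jacobsonSpace (φ ≫ f)
  haveI : LocallyQuasiFinite φ := locallyQuasiFinite_of_etale φ
  -- (a) `φ y` is closed; an affine open `U ∋ φ y`
  have hxcl : IsClosed ({φ y} : Set X) := IsolatedClosed.isClosed_singleton_of_finite_singularLocus K X f hfin hx
  obtain ⟨U, hU, hxU, -⟩ := exists_isAffineOpen_mem_and_subset (X := X) (x := φ y) (U := ⊤) trivial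
  -- (b) the other singular points form a finite closed set
  set T : Set X := (Scheme.regularLocus X)ᶜ \ {φ y} with hT
  have hTclosed : IsClosed T := by
    rw [← Set.biUnion_of_singleton T]
    exact (hfin.subset fun z hz => hz.1).isClosed_biUnion fun z hz =>
      IsolatedClosed.isClosed_singleton_of_finite_singularLocus K X f hfin hz.1
  -- (c) `y` is isolated in its fibre
  obtain ⟨u, huopen, hu⟩ := (isDiscrete_iff_forall_mem_exists_isOpen.mp (φ.isDiscrete_preimage_singleton (φ y)))
    y rfl
  -- (d) the open neighbourhood `W` of `y` and a basic open `D(h) ∋ y` inside it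
  set W : (Spec R).Opens :=
    ⟨u, huopen⟩ ⊓ φ ⁻¹ᵁ ⟨Tᶜ, hTclosed.isOpen_compl⟩ ⊓ φ ⁻¹ᵁ U ⊓ PrimeSpectrum.basicOpen g with hWdef
  have hyW : y ∈ W := by
    refine ⟨⟨⟨?_, ?_⟩, hxU⟩, (PrimeSpectrum.mem_basicOpen _ _).mpr hgy⟩
    · simpa [Set.mem_singleton_iff] using (show y ∈ u ∩ φ ⁻¹' {φ y} by rw [hu]; rfl)
    · show φ y ∈ Tᶜ
      exact fun h => h.2 rfl
  obtain ⟨_, ⟨h, rfl⟩, hyh, hhW⟩ := (Opens.isBasis_iff_nbhd.mp PrimeSpectrum.isBasis_basic_opens) hyW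
  -- (e) the affine open `V = D(h)` and its coordinate ring
  set V : (Spec R).Opens := PrimeSpectrum.basicOpen h with hVdef
  have hV : IsAffineOpen V := by
    rw [hVdef, ← basicOpen_eq_of_affine]
    exact (isAffineOpen_top (Spec R)).basicOpen _
  have hyV : y ∈ V := hyh
  have hVW : V ≤ W := hhW
  haveI : IsNoetherianRing Γ(Spec R, V) := IsLocallyNoetherian.component_noetherian ⟨V, hV⟩
  set 𝔮 := hV.primeIdealOf ⟨y, hyV⟩ with h𝔮def
  -- the chart on `Γ(Spec R, D(h))`
  let ψV : Multiplicative P →* Γ(Spec R, V) := (algebraMap R Γ(Spec R, V)).toMonoidHom.comp ψ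
  have hregV : ∀ (𝔓 : Ideal Γ(Spec R, V)) [𝔓.IsPrime], IsLogRegularAt P ψV 𝔓 := by
    intro 𝔓 _
    refine FixedPointResolvableNhd.isLogRegularAt_of_isLocalization (Submonoid.powers h) P ψ 𝔓 (hreg _ ?_)
    -- `g ∉ 𝔓 ∩ R` since `D(h) ⊆ D(g)`
    have hh𝔓 : h ∉ 𝔓.comap (algebraMap R Γ(Spec R, V)) := fun hh =>
      ‹𝔓.IsPrime›.ne_top (Ideal.eq_top_of_isUnit_mem _ (Ideal.mem_comap.mp hh)
        (IsLocalization.Away.algebraMap_isUnit h))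
    have hmem : (⟨𝔓.comap (algebraMap R Γ(Spec R, V)), inferInstance⟩ : PrimeSpectrum R) ∈ V :=
      (PrimeSpectrum.mem_basicOpen _ _).mpr hh𝔓
    exact (PrimeSpectrum.mem_basicOpen _ _).mp (hVW hmem).2
  have hfixV : ∀ p : P, (p : Fin n → ℤ) ≠ 0 → ψV (Multiplicative.ofAdd p) ∈ 𝔮.asIdeal := fun p hp =>
    (algebraMap_mem_primeIdealOf_iff hV hyV _).mpr (hfix p hp)
  -- (f) every other point of `V` is a regular point
  have hV_W : ∀ {z : Spec R}, z ∈ V → z ≠ y → z ∈ Scheme.regularLocus (Spec R) := by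
    intro z hzV hzy
    have hzW : z ∈ W := hVW hzV
    have hφz : φ z ≠ φ y := fun hzz => hzy (by
      have : z ∈ u ∩ φ ⁻¹' {φ y} := ⟨hzW.1.1.1, hzz⟩
      rw [hu] at this
      exact this)
    have hφreg : φ z ∈ Scheme.regularLocus X := by
      by_contra hc
      exact (show φ z ∈ Tᶜ from hzW.1.1.2) ⟨hc, hφz⟩
    rw [Scheme.mem_regularLocus] at hφreg ⊢
    exact (isRegularLocalRing_stalk_iff_of_etale φ z).mpr hφreg
  have hisolV : ∀ (𝔓 : Ideal Γ(Spec R, V)) [𝔓.IsPrime], 𝔓 ≠ 𝔮.asIdeal →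
      IsRegularLocalRing (Localization.AtPrime 𝔓) := by
    intro 𝔓 _ hne
    set z : PrimeSpectrum Γ(Spec R, V) := ⟨𝔓, inferInstance⟩ with hzdef
    have hzV : hV.fromSpec z ∈ V := hV.range_fromSpec.le ⟨z, rfl⟩
    have hzy : hV.fromSpec z ≠ y := fun hzy => hne (by
      have h2 : hV.fromSpec z = hV.fromSpec 𝔮 := by rw [hzy, h𝔮def, hV.fromSpec_primeIdealOf ⟨y, hyV⟩]
      exact congrArg PrimeSpectrum.asIdeal (hV.fromSpec.isOpenEmbedding.injective h2))
    have hz := hV_W hzV hzy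
    rw [mem_regularLocus_fromSpec_iff hV, mem_regularLocus] at hz
    exact hz
  -- (g) the face fan is not regular: else `y`, hence `φ y`, would be a regular point
  have hnregV : ¬ (Fan.ofCone (dualCone P) (dualCone_fg P hP) (isSalient_dualCone P hspan)).IsRegular := by
    intro hΔ
    have hregq : IsRegularLocalRing (Localization.AtPrime 𝔮.asIdeal) :=
      isRegularLocalRing_of_isRegular_ofCone hP hsat hspan (hregV 𝔮.asIdeal) hfixV hΔ
    have hyreg : y ∈ Scheme.regularLocus (Spec R) := by
      have h1 := (mem_regularLocus_fromSpec_iff hV 𝔮).mpr ((mem_regularLocus 𝔮).mpr hregq)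
      rwa [h𝔮def, hV.fromSpec_primeIdealOf ⟨y, hyV⟩] at h1
    rw [Scheme.mem_regularLocus] at hyreg
    exact hx ((Scheme.mem_regularLocus _).mpr ((isRegularLocalRing_stalk_iff_of_etale φ y).mp hyreg))
  -- (g′) `dim Γ(Spec R, V)_𝔮 = n`, DERIVED: the Kato ideal is `𝔮`-primary at an isolated singular fixed point (κ″)
  have hdimV : ringKrullDim (Localization.AtPrime 𝔮.asIdeal) = n :=
    RegularPointRegularCone.ringKrullDim_eq_of_isolated hP hsat hspan hregV 𝔮.asIdeal hfixV hisolV hnregV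
  -- (h) `y` is a closed point: `𝔮` is maximal (unramified over the maximal ideal of `φ y`), and `Spec R` is Jacobson
  have h𝔮max : 𝔮.asIdeal.IsMaximal := by
    set 𝔭 := hU.primeIdealOf ⟨φ y, hxU⟩ with h𝔭def
    haveI h𝔭max : 𝔭.asIdeal.IsMaximal := hU.primeIdealOf_isMaximal_of_isClosed ⟨φ y, hxU⟩ hxcl
    have eVU : V ≤ φ ⁻¹ᵁ U := fun z hz => (hVW hz).1.2
    have hψ' : (φ.appLE U V eVU).hom.Etale := φ.etale_appLE hU hV eVU
    letI : Algebra Γ(X, U) Γ(Spec R, V) := (φ.appLE U V eVU).hom.toAlgebra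
    haveI : Algebra.Etale Γ(X, U) Γ(Spec R, V) := hψ'
    have hcomap : 𝔮.asIdeal.comap (algebraMap Γ(X, U) Γ(Spec R, V)) = 𝔭.asIdeal :=
      congrArg PrimeSpectrum.asIdeal (hU.comap_primeIdealOf_appLE (f := φ) U V hV eVU hyV)
    exact EtaleChartPrimaryCentreAlgClosed.isMaximal_of_isMaximal_comap_of_formallyUnramified 𝔮.asIdeal
      (hcomap ▸ h𝔭max)
  have hycl : IsClosed ({y} : Set (Spec R)) := by
    have h1 : IsClosed ({𝔮} : Set (PrimeSpectrum Γ(Spec R, V))) :=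
      (PrimeSpectrum.isClosed_singleton_iff_isMaximal 𝔮).mpr h𝔮max
    have h2 : 𝔮 ∈ hV.fromSpec ⁻¹' closedPoints (Spec R) := by
      rw [hV.fromSpec.isOpenEmbedding.preimage_closedPoints]
      exact h1
    have h3 : hV.fromSpec 𝔮 ∈ closedPoints (Spec R) := h2
    rw [h𝔮def, hV.fromSpec_primeIdealOf ⟨y, hyV⟩] at h3
    exact h3
  -- (i) assemble (ε₂′)'s chart data
  exact ⟨Spec R, φ, inferInstance, y, rfl, hycl, V, hV, hyV, inferInstance, n, P, hP, hsat, hspan, ψV,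
    hregV, hfixV, hdimV, hisolV, hps, hnregV⟩

end Summit.ResolutionOfSingularities.ResolutionOfSingularities.Theorems.FRationalResolution.IsolatedAffineLogRegularChartResolution

end
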